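import Mathlib
import Literature.NumberTheory.LFunctions.WeilGroundState
import Literature.NumberTheory.LFunctions.WeilGroundStateRealZerosProofs
import Summits.RiemannHypothesis.RiemannHypothesis.Theorems.WeilGroundStateGroundStateSimpleEvenStubOddPrimitive
import Summits.RiemannHypothesis.RiemannHypothesis.Theorems.WeilGroundStateGroundStateSimpleEvenStubPairPrelim
import HarnessLib

/-!
# Crux `GroundStateSimpleEven` (stmt-RiemannHypothesis-1526), line `parity-multiplicity-commutator`
# (v2), stub PAIR `stub_oddMinimisers_of_evenPair`: an orthogonal even pair yields odd minimisers

Support file (`--supports stmt-RiemannHypothesis-1526`) proving the registered stub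
`stub_oddMinimisers_of_evenPair` of the v2 skeleton verbatim, from the landed sub-goals
(OP) `stub_oddPrimitive_approximants` (p135663), (PC1) `stub_pairContinuity_polarPrime` (p135583),
(PC2) `stub_pairContinuity_arch` (p135667) and the preliminaries `stub_pairContinuity`,
`stub_windowPrimitive_ne_zero` (…StubPairPrelim.lean).  Normalisation of
`Literature/NumberTheory/LFunctions/WeilExplicit.lean`: `W = weilFunctional`, `Q g = W(g ⋆ g̃)`,
`g̃ = weilReflect g`, `⋆ = weilConv`, `ε = ε(a) = weilGroundEnergy a`,
`q(f) = Re Q(f) − ε ∫|f|²` (`≥ 0` on window test functions).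

## Statement

Two `L²`-orthogonal EVEN ground states `u₁, u₂` at the same window `a > 0` yield an ODD
`L²`-normalised minimising sequence of window test functions: `Re Q(oₙ) → ε(a)`.

## Proof (the antiderivative intertwiner)

1. Pair continuity (…StubPairPrelim.lean): `‖W(f ⋆ h̃)‖ ≤ C ‖f‖₂ (‖h‖₂ + ‖h'‖₂)` for window
   test functions.
2. Choose `(c₁, c₂) ≠ 0` with `∫ (c₂u₁ − c₁u₂) = 0` (`cᵢ = ∫ uᵢ`, or `(0, 1)` if both vanish).
   The window primitive `U = ∫_{-a}^t (c₂u₁ − c₁u₂)` is non-zero in `L²` (…StubPairPrelim.lean).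
3. (OP) gives odd window tests `oₙ → U` in `L²` with `∫|oₙ'|² ≤ M` and
   `W(oₘ ⋆ õₙ) → ε ∫ U conj oₙ` as `m → ∞` (for each fixed `n`).  Writing
   `W(oₙ ⋆ õₙ) − ε‖oₙ‖² = W((oₙ − oₘ) ⋆ õₙ) + (W(oₘ ⋆ õₙ) − ε⟨U, oₙ⟩) + ε⟨U − oₙ, oₙ⟩`
   and letting `m → ∞` (§1 below): `|q(oₙ)| ≤ (C(‖oₙ‖₂ + √M) + |ε|‖oₙ‖₂) ‖oₙ − U‖₂ → 0`.
4. `∫|oₙ|² → ∫|U|² > 0`; normalise (§2 below).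

Mathlib + proved tree files only; no definitions, no named facts.
-/

noncomputable section

open Set MeasureTheory Filter Complex
open scoped Real Topology ComplexConjugate

namespace Summit.RiemannHypothesis.RiemannHypothesis.Theorems.GroundStateSimpleEven

open Literature.NumberTheory.LFunctions

-- `linter.dupNamespace` off: the mandated namespace `Summit.RiemannHypothesis.RiemannHypothesis.…`
-- (single-problem summit) repeats a component.
set_option linter.dupNamespace false

/-! ## §1. The shifted forms of the odd approximants vanish -/

section ShiftedForm

variable {a : ℝ} {U : ℝ → ℂ} {o : ℕ → ℝ → ℂ}

/-- **The key estimate.** Let `a > 0`, `U ∈ L²`, and odd window test functions `oₙ → U` in `L²`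
with `∫|oₙ'|² ≤ M` and, for each `n`, `W(oₘ ⋆ õₙ) → ε(a) ∫ U conj oₙ` as `m → ∞`.  Then with the
pair-continuity constant `C`:
`‖Q(oₙ) − ε(a)∫|oₙ|²‖ ≤ (C (‖oₙ‖₂ + √M) + |ε(a)| ‖oₙ‖₂) ‖oₙ − U‖₂` for every `n`
(`Q(oₙ) − ε‖oₙ‖² = W((oₙ − oₘ) ⋆ õₙ) + (W(oₘ ⋆ õₙ) − ε⟨U, oₙ⟩) + ε⟨U − oₙ, oₙ⟩`, let `m → ∞`).
[folklore] -/
theorem norm_weilQuadratic_sub_le_of_approximants (hUm : MemLp U 2)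
    (ho : ∀ n, IsWeilTest (o n) ∧ tsupport (o n) ⊆ Icc (-a) a)
    (hoL : Tendsto (fun n ↦ ∫ t, ‖o n t - U t‖ ^ 2) atTop (𝓝 0)) {M : ℝ}
    (hM : ∀ n, ∫ t, ‖deriv (o n) t‖ ^ 2 ≤ M)
    (hEL : ∀ n, Tendsto (fun m ↦ weilFunctional (weilConv (o m) (weilReflect (o n)))) atTop
      (𝓝 ((weilGroundEnergy a : ℂ) * ∫ t, U t * conj (o n t))))
    {C : ℝ} (hC0 : 0 ≤ C)
    (hC : ∀ f h : ℝ → ℂ, IsWeilTest f → tsupport f ⊆ Icc (-a) a →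
      IsWeilTest h → tsupport h ⊆ Icc (-a) a →
        ‖weilFunctional (weilConv f (weilReflect h))‖ ≤
          C * √(∫ t, ‖f t‖ ^ 2) * (√(∫ t, ‖h t‖ ^ 2) + √(∫ t, ‖deriv h t‖ ^ 2))) (n : ℕ) :
    ‖weilQuadratic (o n) - ((weilGroundEnergy a * ∫ t, ‖o n t‖ ^ 2 : ℝ) : ℂ)‖ ≤
      (C * (√(∫ t, ‖o n t‖ ^ 2) + √M) + |weilGroundEnergy a| * √(∫ t, ‖o n t‖ ^ 2)) *
        √(∫ t, ‖o n t - U t‖ ^ 2) := by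
  set ε : ℝ := weilGroundEnergy a with hε
  have hom : ∀ m, MemLp (o m) 2 := fun m ↦ ConnesVanSuijlekom.isWeilTest_memLp (ho m).1
  set Nn : ℝ := ∫ t, ‖o n t‖ ^ 2 with hNn
  set D : ℕ → ℝ := fun m ↦ ∫ t, ‖o n t - o m t‖ ^ 2 with hD
  set Dlim : ℝ := ∫ t, ‖o n t - U t‖ ^ 2 with hDlim
  -- the decomposition, for every `m`
  have hdec : ∀ m, weilQuadratic (o n) - ((ε * Nn : ℝ) : ℂ) =
      weilFunctional (weilConv (o n - o m) (weilReflect (o n))) +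
        (weilFunctional (weilConv (o m) (weilReflect (o n))) - (ε : ℂ) * ∫ t, U t * conj (o n t)) +
        (ε : ℂ) * ((∫ t, U t * conj (o n t)) - ∫ t, o n t * conj (o n t)) := by
    intro m
    have h1 := weilFunctional_weilConv_sub_left (ho n).1 (ho m).1 (ho n).1
    have h2 : ∫ t, o n t * conj (o n t) = ((Nn : ℝ) : ℂ) :=
      ConnesVanSuijlekom.integral_mul_conj_self (o n)
    rw [h1, h2]
    unfold weilQuadratic
    push_cast
    ring
  -- bound for every `m`
  have hbound : ∀ m, ‖weilQuadratic (o n) - ((ε * Nn : ℝ) : ℂ)‖ ≤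
      C * √(D m) * (√Nn + √M) +
        ‖weilFunctional (weilConv (o m) (weilReflect (o n))) - (ε : ℂ) * ∫ t, U t * conj (o n t)‖ +
        |ε| * (√Dlim * √Nn) := by
    intro m
    rw [hdec m]
    refine (norm_add₃_le).trans (add_le_add (add_le_add ?_ le_rfl) ?_)
    · have hsub : IsWeilTest (o n - o m) := IsWeilTest.sub (ho n).1 (ho m).1
      have hsubs : tsupport (o n - o m) ⊆ Icc (-a) a := tsupport_sub_subset_Icc (ho n).2 (ho m).2
      have h := hC (o n - o m) (o n) hsub hsubs (ho n).1 (ho n).2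
      refine h.trans ?_
      have hD' : √(∫ t, ‖(o n - o m) t‖ ^ 2) = √(D m) := by simp only [hD, Pi.sub_apply]
      rw [hD']
      have hM' : √(∫ t, ‖deriv (o n) t‖ ^ 2) ≤ √M := Real.sqrt_le_sqrt (hM n)
      have : C * √(D m) * (√Nn + √(∫ t, ‖deriv (o n) t‖ ^ 2)) ≤ C * √(D m) * (√Nn + √M) := by
        gcongr
      exact this
    · rw [norm_mul, Complex.norm_real, Real.norm_eq_abs]
      refine mul_le_mul_of_nonneg_left ?_ (abs_nonneg ε)
      have hi1 : Integrable fun t ↦ U t * conj (o n t) :=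
        hUm.integrable_mul (ConnesVanSuijlekom.memLp_conj (hom n))
      have hi2 : Integrable fun t ↦ o n t * conj (o n t) :=
        (hom n).integrable_mul (ConnesVanSuijlekom.memLp_conj (hom n))
      rw [← integral_sub hi1 hi2]
      have e : (fun t ↦ U t * conj (o n t) - o n t * conj (o n t)) =
          fun t ↦ (U t - o n t) * conj (o n t) := by
        funext t; ring
      rw [e]
      have h := ConnesVanSuijlekom.norm_integral_mul_conj_sub_le (hUm.sub (hom n)) (hom n)
        (MemLp.zero' (p := 2) (μ := volume))
      simp only [Pi.sub_apply, map_zero, mul_zero, integral_zero, sub_zero] at h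
      refine h.trans (le_of_eq ?_)
      congr 2
      refine integral_congr_ae (Eventually.of_forall fun t ↦ ?_)
      simp only [norm_sub_rev]
  -- the right-hand side converges as `m → ∞`
  have hDlim' : Tendsto D atTop (𝓝 Dlim) := by
    have h := ConnesVanSuijlekom.tendsto_integral_norm_sq ((hom n).sub hUm)
      (fun m ↦ (hom n).sub (hom m)) (f := fun m t ↦ o n t - o m t) (F := fun t ↦ o n t - U t) ?_
    · exact h
    · refine hoL.congr fun m ↦ ?_
      congr 1 with t
      rw [show o n t - o m t - (o n t - U t) = -(o m t - U t) by ring, norm_neg]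
  have hT : Tendsto (fun m ↦ C * √(D m) * (√Nn + √M) +
      ‖weilFunctional (weilConv (o m) (weilReflect (o n))) - (ε : ℂ) * ∫ t, U t * conj (o n t)‖ +
      |ε| * (√Dlim * √Nn)) atTop
      (𝓝 (C * √Dlim * (√Nn + √M) + 0 + |ε| * (√Dlim * √Nn))) := by
    refine ((((hDlim'.sqrt).const_mul C).mul_const _).add ?_).add tendsto_const_nhds
    have h := hEL n
    rw [tendsto_iff_norm_sub_tendsto_zero] at h
    exact h
  have hle := ge_of_tendsto' hT hbound
  rw [add_zero] at hle
  refine hle.trans (le_of_eq ?_)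
  ring

/-- **The shifted forms vanish**: in the setting of `norm_weilQuadratic_sub_le_of_approximants`,
`Re Q(oₙ) − ε(a) ∫|oₙ|² → 0` (the approximants are `L²`-bounded since `∫|oₙ|² → ∫|U|²`).
[folklore] -/
theorem tendsto_shiftedForm_of_approximants (hUm : MemLp U 2)
    (ho : ∀ n, IsWeilTest (o n) ∧ tsupport (o n) ⊆ Icc (-a) a)
    (hoL : Tendsto (fun n ↦ ∫ t, ‖o n t - U t‖ ^ 2) atTop (𝓝 0)) {M : ℝ}
    (hM : ∀ n, ∫ t, ‖deriv (o n) t‖ ^ 2 ≤ M)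
    (hEL : ∀ n, Tendsto (fun m ↦ weilFunctional (weilConv (o m) (weilReflect (o n)))) atTop
      (𝓝 ((weilGroundEnergy a : ℂ) * ∫ t, U t * conj (o n t))))
    {C : ℝ} (hC0 : 0 ≤ C)
    (hC : ∀ f h : ℝ → ℂ, IsWeilTest f → tsupport f ⊆ Icc (-a) a →
      IsWeilTest h → tsupport h ⊆ Icc (-a) a →
        ‖weilFunctional (weilConv f (weilReflect h))‖ ≤
          C * √(∫ t, ‖f t‖ ^ 2) * (√(∫ t, ‖h t‖ ^ 2) + √(∫ t, ‖deriv h t‖ ^ 2))) :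
    Tendsto (fun n ↦ (weilQuadratic (o n)).re - weilGroundEnergy a * ∫ t, ‖o n t‖ ^ 2)
      atTop (𝓝 0) := by
  set ε : ℝ := weilGroundEnergy a with hε
  have hom : ∀ m, MemLp (o m) 2 := fun m ↦ ConnesVanSuijlekom.isWeilTest_memLp (ho m).1
  -- norms converge, hence are eventually bounded by `ν + 1`
  set ν : ℝ := ∫ t, ‖U t‖ ^ 2 with hν
  have hN : Tendsto (fun n ↦ ∫ t, ‖o n t‖ ^ 2) atTop (𝓝 ν) :=
    ConnesVanSuijlekom.tendsto_integral_norm_sq hUm hom hoL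
  have hν0 : 0 ≤ ν := integral_nonneg fun _ ↦ by positivity
  set B : ℝ := √(ν + 1) with hB
  have hevB : ∀ᶠ n in atTop, √(∫ t, ‖o n t‖ ^ 2) ≤ B :=
    (hN.eventually (Iio_mem_nhds (by linarith : ν < ν + 1))).mono fun n hn ↦
      Real.sqrt_le_sqrt hn.le
  -- squeeze with the key estimate
  have hkey := norm_weilQuadratic_sub_le_of_approximants hUm ho hoL hM hEL hC0 hC
  rw [tendsto_zero_iff_norm_tendsto_zero]
  have hup : Tendsto (fun n ↦ (C * (B + √M) + |ε| * B) * √(∫ t, ‖o n t - U t‖ ^ 2)) atTop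
      (𝓝 0) := by
    have h := (hoL.sqrt).const_mul (C * (B + √M) + |ε| * B)
    rw [Real.sqrt_zero, mul_zero] at h
    exact h
  refine squeeze_zero' (Eventually.of_forall fun n ↦ norm_nonneg _) ?_ hup
  filter_upwards [hevB] with n hn
  have h1 : ‖(weilQuadratic (o n)).re - ε * ∫ t, ‖o n t‖ ^ 2‖ ≤
      ‖weilQuadratic (o n) - ((ε * ∫ t, ‖o n t‖ ^ 2 : ℝ) : ℂ)‖ := by
    have h := Complex.abs_re_le_norm (weilQuadratic (o n) - ((ε * ∫ t, ‖o n t‖ ^ 2 : ℝ) : ℂ))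
    rw [Complex.sub_re, Complex.ofReal_re] at h
    rw [Real.norm_eq_abs]
    exact h
  refine h1.trans ((hkey n).trans ?_)
  have hD0 : 0 ≤ √(∫ t, ‖o n t - U t‖ ^ 2) := Real.sqrt_nonneg _
  refine mul_le_mul_of_nonneg_right ?_ hD0
  gcongr

end ShiftedForm

/-! ## §2. Assembly: odd minimisers from an orthogonal even pair -/

section Assembly

variable {a : ℝ} {u₁ u₂ : ℝ → ℂ}

/-- **An orthogonal even pair yields odd minimisers.** Two `L²`-orthogonal EVEN ground states
`u₁, u₂` at the same window `a > 0` yield an ODD `L²`-normalised minimising sequence of window test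
functions, `Re Q(oₙ) → ε(a)` (module docstring, steps 1–4). [folklore] -/
theorem oddMinimisers_of_evenPair (hu₁ : IsWeilGroundState a u₁) (hu₂ : IsWeilGroundState a u₂)
    (hev₁ : ∀ t, u₁ (-t) = u₁ t) (hev₂ : ∀ t, u₂ (-t) = u₂ t)
    (horth : ∫ t, starRingEnd ℂ (u₁ t) * u₂ t = 0) :
    ∃ o : ℕ → ℝ → ℂ, (∀ n, IsWeilTest (o n) ∧ tsupport (o n) ⊆ Icc (-a) a ∧
      ∫ t, ‖o n t‖ ^ 2 = (1 : ℝ) ∧ ∀ t, o n (-t) = -o n t) ∧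
      Tendsto (fun n ↦ (weilQuadratic (o n)).re) atTop (𝓝 (weilGroundEnergy a)) := by
  have ha : 0 < a := hu₁.pos
  set ε : ℝ := weilGroundEnergy a with hε
  -- (1) the scalars: `∫ (c₂u₁ − c₁u₂) = 0` with `(c₁, c₂) ≠ 0`
  set I₁ : ℂ := ∫ t, u₁ t with hI₁
  set I₂ : ℂ := ∫ t, u₂ t with hI₂
  obtain ⟨c₁, c₂, hc, hG0⟩ : ∃ c₁ c₂ : ℂ, (c₁ ≠ 0 ∨ c₂ ≠ 0) ∧
      ∫ t, (c₂ * u₁ t - c₁ * u₂ t) = 0 := by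
    have hsplit : ∀ c₁ c₂ : ℂ, ∫ t, (c₂ * u₁ t - c₁ * u₂ t) = c₂ * I₁ - c₁ * I₂ := by
      intro c₁ c₂
      rw [integral_sub (hu₁.integrable.const_mul c₂) (hu₂.integrable.const_mul c₁),
        integral_const_mul, integral_const_mul]
    by_cases h : I₁ = 0 ∧ I₂ = 0
    · refine ⟨0, 1, Or.inr one_ne_zero, ?_⟩
      rw [hsplit, h.1, h.2]
      ring
    · refine ⟨I₁, I₂, ?_, ?_⟩
      · rcases not_and_or.1 h with h1 | h2
        · exact Or.inl h1
        · exact Or.inr h2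
      · rw [hsplit]
        ring
  -- (2) the window primitive `U` and its odd approximants
  set G : ℝ → ℂ := fun t ↦ c₂ * u₁ t - c₁ * u₂ t with hG
  have hGm : MemLp G 2 := (hu₁.memLp.const_mul c₂).sub (hu₂.memLp.const_mul c₁)
  have hGz : ∀ᵐ t : ℝ, t ∉ Icc (-a) a → G t = 0 := by
    filter_upwards [hu₁.ae_eq_zero_of_notMem, hu₂.ae_eq_zero_of_notMem] with t h1 h2 ht
    simp only [hG]
    rw [h1 ht, h2 ht, mul_zero, mul_zero, sub_zero]
  have hGi : Integrable G := integrable_of_memLp_two_window hGm hGz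
  set U : ℝ → ℂ := fun t ↦ ∫ s in (-a)..t, G s with hU
  have hUm : MemLp U 2 := memLp_two_primitive_window ha.le hGi hGz hG0
  have hν : 0 < ∫ t, ‖U t‖ ^ 2 := integral_norm_sq_primitive_pos hu₁ hu₂ horth hc hG0
  obtain ⟨o, ho, hoL, ⟨M, hM⟩, hEL⟩ :=
    stub_oddPrimitive_approximants a ha u₁ u₂ hu₁ hu₂ hev₁ hev₂ c₁ c₂ hG0
  obtain ⟨C, hC0, hC⟩ := exists_norm_weilFunctional_pair_le ha
  have hom : ∀ n, MemLp (o n) 2 := fun n ↦ ConnesVanSuijlekom.isWeilTest_memLp (ho n).1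
  -- (3) shifted forms vanish, norms converge
  have hq : Tendsto (fun n ↦ (weilQuadratic (o n)).re - ε * ∫ t, ‖o n t‖ ^ 2) atTop (𝓝 0) :=
    tendsto_shiftedForm_of_approximants hUm (fun n ↦ ⟨(ho n).1, (ho n).2.1⟩) hoL hM
      (fun n ↦ hEL (o n) (ho n).1 (ho n).2.1 (ho n).2.2) hC0 hC
  set ν : ℝ := ∫ t, ‖U t‖ ^ 2 with hνdef
  have hN : Tendsto (fun n ↦ ∫ t, ‖o n t‖ ^ 2) atTop (𝓝 ν) :=
    ConnesVanSuijlekom.tendsto_integral_norm_sq hUm hom hoL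
  have hQ : Tendsto (fun n ↦ (weilQuadratic (o n)).re) atTop (𝓝 (ε * ν)) := by
    have h1 := hq.add (hN.const_mul ε)
    rw [zero_add] at h1
    exact h1.congr fun n ↦ by ring
  -- (4) normalise from the index on where `∫|oₙ|² > ν/2`
  set Nn : ℕ → ℝ := fun n ↦ ∫ t, ‖o n t‖ ^ 2 with hNn
  obtain ⟨N₀, hN₀⟩ := eventually_atTop.1 (hN.eventually (lt_mem_nhds (show ν / 2 < ν by linarith)))
  have hpos : ∀ n, 0 < Nn (n + N₀) := fun n ↦ by
    have h1 := hN₀ (n + N₀) (Nat.le_add_left _ _)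
    have h2 : Nn (n + N₀) = ∫ t, ‖o (n + N₀) t‖ ^ 2 := rfl
    linarith
  refine ⟨fun n t ↦ (((√(Nn (n + N₀)))⁻¹ : ℝ) : ℂ) * o (n + N₀) t, fun n ↦ ⟨?_, ?_, ?_, ?_⟩, ?_⟩
  · exact (ho _).1.const_mul _
  · exact tsupport_mul_subset_right.trans (ho _).2.1
  · simp only [norm_mul, mul_pow, Complex.norm_real, Real.norm_of_nonneg
      (inv_nonneg.2 (Real.sqrt_nonneg _))]
    rw [integral_const_mul, inv_pow, Real.sq_sqrt (hpos n).le]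
    exact inv_mul_cancel₀ (hpos n).ne'
  · intro t
    beta_reduce
    rw [(ho _).2.2, mul_neg]
  · have h1 : ∀ n, (weilQuadratic fun t ↦ (((√(Nn (n + N₀)))⁻¹ : ℝ) : ℂ) * o (n + N₀) t).re =
        (weilQuadratic (o (n + N₀))).re / Nn (n + N₀) := by
      intro n
      rw [weilQuadratic_const_mul, Complex.normSq_ofReal, Complex.re_ofReal_mul, ← mul_inv,
        Real.mul_self_sqrt (hpos n).le, inv_mul_eq_div]
    simp_rw [h1]
    have h2 : Tendsto (fun n ↦ (weilQuadratic (o n)).re / Nn n) atTop (𝓝 (ε * ν / ν)) :=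
      hQ.div hN hν.ne'
    rw [mul_div_assoc, div_self hν.ne', mul_one] at h2
    exact (tendsto_add_atTop_iff_nat N₀).2 h2

end Assembly

end Summit.RiemannHypothesis.RiemannHypothesis.Theorems.GroundStateSimpleEven

namespace Summit.RiemannHypothesis.RiemannHypothesis.Theorems

open Literature.NumberTheory.LFunctions

set_option linter.dupNamespace false in
/-- **Registered stub PAIR of line `parity-multiplicity-commutator` (v2): an orthogonal even pair
of ground states yields odd minimisers.** Two `L²`-orthogonal EVEN ground states `u₁, u₂` at the
same window `a > 0` yield an ODD `L²`-normalised minimising sequence of window test functions,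
`Re Q(oₙ) → ε(a)`.  Mechanism (the antiderivative intertwiner): the odd window primitive
`U = ∫_{-a}^t (c₂u₁ − c₁u₂)` of a mean-zero non-trivial combination satisfies the weak
eigen-equation against odd window tests (OP, p135663), is non-zero, and is the `L²`-limit of odd
window tests with bounded `H¹`-seminorm, whose shifted forms vanish by the pair continuity of the
Weil form on `L² × H¹` (PC1 p135583, PC2 p135667); normalise
(`GroundStateSimpleEven.oddMinimisers_of_evenPair`). [folklore] -/
theorem stub_oddMinimisers_of_evenPair :
    ∀ a : ℝ, 0 < a → ∀ u₁ u₂ : ℝ → ℂ, IsWeilGroundState a u₁ → IsWeilGroundState a u₂ →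
      (∀ t, u₁ (-t) = u₁ t) → (∀ t, u₂ (-t) = u₂ t) → ∫ t, starRingEnd ℂ (u₁ t) * u₂ t = 0 →
        ∃ o : ℕ → ℝ → ℂ, (∀ n, IsWeilTest (o n) ∧ tsupport (o n) ⊆ Icc (-a) a ∧
          ∫ t, ‖o n t‖ ^ 2 = (1 : ℝ) ∧ ∀ t, o n (-t) = -o n t) ∧
          Tendsto (fun n => (weilQuadratic (o n)).re) atTop (𝓝 (weilGroundEnergy a)) :=
  fun _ _ _ _ hu₁ hu₂ hev₁ hev₂ horth =>
    GroundStateSimpleEven.oddMinimisers_of_evenPair hu₁ hu₂ hev₁ hev₂ horth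

end Summit.RiemannHypothesis.RiemannHypothesis.Theorems

end
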